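import Summits.KontsevichZagierPeriods.Zeta5Search.TwoTaleP15SecondTaleBSharp

/-!
# The two-tale point P15, second tale: `A_k, B_k ∈ ℤ_p` for the large primes `p > 17n`, and the `ℓ = p` slice
# of the alternating harmonic sums

HONEST FRAMING: systematic search; no irrationality claim unless certified.

Cell pub-zeta5, T3 service for the (bmiss)-free closing of the P15 chain (fam-denom `families/denom/P15KERNEL.md`
§10.7–10.8, input `TopWindowT`; P1 `pub-zeta5-p1/TWODECAY-ROUTE-g10.md`).  Denominator side only; nothing about
irrationality.  For a prime `p > 17n` (so `26n < p²`, `p` odd) at the Remark-5 partner `(aT n, bT n)` of P15: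
* `padicNorm_coefAT_le_one`, **`padicNorm_coefBT_le_one`** — `‖A_k‖_p ≤ 1` (`15n+1 ≤ k ≤ 24n+1`) and `‖B_k‖_p ≤ 1`
  (`13n+1 ≤ k ≤ 26n+1`): the digit count `E(k) ≥ 1` in the zones β₁/γ, and in zone β₂ either `E(k) ≥ 1` (a
  linear-factor value at `−k` is a multiple of `p`) or the δ-refined bound `padicNorm_coefBT_zoneB2_sharp` applies
  — this is eq. (T3) of [Zudilin 2014, §6] (`D_{17n} B_k ∈ ℤ`) at the primes not dividing `D_{17n}`;
* `padicNorm_harmAlt2_sub_le`, `padicNorm_harmAlt1_sub_le` — for `p ≤ m < 2p` the sums `Σ_{ℓ≤m} (−1)^{ℓ−1}/ℓ^s`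
  (`s = 2, 1`) are `1/p^s +` a `p`-integral rational (only `ℓ = p` has a `p` in the denominator; `p − 1` is even);
* half-integer units: `‖(p + 2d)/2‖_p = 1` for `0 < |d| < p` (`padicNorm_shift_half_eq_one`), `‖p/2‖_p = p⁻¹`.
The slice lemma itself (`‖p̂_n‖_p ≤ 1` for `p > 17n`) is assembled in `TwoTaleP15Slice.lean`.
-/

noncomputable section

namespace Summit.KontsevichZagierPeriods.Zeta5Search.TwoTaleP15

open Finset Polynomial
open Literature.NumberTheory.Irrationality.Zudilin2014

section Units

variable {p : ℕ} [hp : Fact p.Prime]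

/-- `‖z/2‖_p ≤ 1` for an integer `z` and odd `p`. -/
theorem padicNorm_half_int_le_one (h2 : p ≠ 2) (z : ℤ) : padicNorm p ((z : ℚ) / 2) ≤ 1 := by
  have h2n : padicNorm p (2 : ℚ) = 1 := by
    simpa using padicNorm.padicNorm_of_prime_of_ne (p := p) (q := 2) h2
  rw [padicNorm.div, h2n, div_one]; exact padicNorm.of_int z

/-- `‖z/2‖_p = 1` for an integer `z` prime to the odd prime `p`. -/
theorem padicNorm_half_int_eq_one (h2 : p ≠ 2) {z : ℤ} (hz : ¬ (p : ℤ) ∣ z) : padicNorm p ((z : ℚ) / 2) = 1 := by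
  have h2n : padicNorm p (2 : ℚ) = 1 := by
    simpa using padicNorm.padicNorm_of_prime_of_ne (p := p) (q := 2) h2
  rw [padicNorm.div, h2n, div_one]; exact (padicNorm.int_eq_one_iff z).2 hz

/-- `‖p/2‖_p = p⁻¹` for odd `p`. -/
theorem padicNorm_half_p (h2 : p ≠ 2) : padicNorm p ((p : ℚ) / 2) = (p : ℚ)⁻¹ := by
  have h2n : padicNorm p (2 : ℚ) = 1 := by
    simpa using padicNorm.padicNorm_of_prime_of_ne (p := p) (q := 2) h2
  rw [padicNorm.div, h2n, div_one, padicNorm.padicNorm_p_of_prime]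

/-- For odd `p` and `0 < |d| < p`: `p ∤ p + 2d`. -/
theorem not_dvd_shift (h2 : p ≠ 2) {d : ℤ} (hd0 : d ≠ 0) (hd : d.natAbs < p) : ¬ (p : ℤ) ∣ (p : ℤ) + 2 * d := by
  intro h
  have h2d : (p : ℤ) ∣ 2 * d := by simpa using dvd_sub h (dvd_refl (p : ℤ))
  have hpr : Prime (p : ℤ) := Nat.prime_iff_prime_int.1 hp.out
  rcases hpr.dvd_or_dvd h2d with h | h
  · have h' : p ∣ 2 := by exact_mod_cast h
    have := (Nat.prime_dvd_prime_iff_eq hp.out Nat.prime_two).1 h'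
    exact h2 this
  · have : p ≤ d.natAbs := Nat.le_of_dvd (Int.natAbs_pos.2 hd0) (by
      have := Int.natAbs_dvd_natAbs.2 h; simpa using this)
    omega

/-- **Half-integer units**: `‖(p + 2d)/2‖_p = 1` for odd `p` and `0 < |d| < p`. -/
theorem padicNorm_shift_half_eq_one (h2 : p ≠ 2) {d : ℤ} (hd0 : d ≠ 0) (hd : d.natAbs < p) :
    padicNorm p ((((p : ℤ) + 2 * d : ℤ) : ℚ) / 2) = 1 :=
  padicNorm_half_int_eq_one h2 (not_dvd_shift h2 hd0 hd)

/-- A product of rationals of norm `≤ 1` has norm `≤ 1`. -/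
theorem padicNorm_prod_le_one {s : Finset ℤ} {f : ℤ → ℚ} (h : ∀ i ∈ s, padicNorm p (f i) ≤ 1) :
    padicNorm p (∏ i ∈ s, f i) ≤ 1 := by
  refine Finset.prod_induction f (fun x => padicNorm p x ≤ 1) (fun a b ha hb => ?_) (by simp) h
  rw [padicNorm.mul]; exact mul_le_one₀ ha (padicNorm.nonneg _) hb

/-- A product of rationals of norm `1` has norm `1`. -/
theorem padicNorm_prod_eq_one {s : Finset ℤ} {f : ℤ → ℚ} (h : ∀ i ∈ s, padicNorm p (f i) = 1) :
    padicNorm p (∏ i ∈ s, f i) = 1 := by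
  refine Finset.prod_induction f (fun x => padicNorm p x = 1) (fun a b ha hb => ?_) (by simp) h
  rw [padicNorm.mul, ha, hb, one_mul]

end Units

/-! ### The `ℓ = p` slice of the alternating harmonic sums -/

section Harmonic

variable {p : ℕ} [hp : Fact p.Prime]

omit hp in
/-- For `ℓ < m < 2p`, `ℓ ≠ p − 1`: `p ∤ ℓ + 1`. -/
theorem not_dvd_succ_of_lt_two_mul {m l : ℕ} (hm : m < 2 * p) (hl : l < m) (hne : l ≠ p - 1) :
    ¬ (p : ℤ) ^ (0 + 1) ∣ ((l : ℤ) + 1) := by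
  rw [zero_add, pow_one]
  intro h
  have h' : p ∣ l + 1 := by exact_mod_cast h
  obtain ⟨c, hc⟩ := h'
  rcases c with _ | _ | c
  · omega
  · omega
  · have : p * 2 ≤ p * (c + 1 + 1) := Nat.mul_le_mul_left _ (by omega)
    omega

/-- `‖(−1)^ℓ/(ℓ+1)^2‖_p ≤ 1` when `p ∤ ℓ+1`. -/
theorem padicNorm_altTerm2_le_one {l : ℕ} (h : ¬ (p : ℤ) ^ (0 + 1) ∣ ((l : ℤ) + 1)) :
    padicNorm p ((-1 : ℚ) ^ l / ((l : ℚ) + 1) ^ 2) ≤ 1 := by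
  have hs : padicNorm p ((-1 : ℚ) ^ l) ≤ 1 := by
    have := padicNorm.of_int (p := p) ((-1) ^ l); push_cast at this; exact this
  have hne : ((l : ℤ) + 1) ≠ 0 := by omega
  have h1 : padicNorm p (1 / (((l + 1 : ℤ) : ℤ) : ℚ)) ≤ (p : ℚ) ^ ((0 : ℕ) : ℤ) :=
    padicNorm_inv_int_le_pow (p := p) hne (j := 0) h
  have h1' : padicNorm p (1 / ((l : ℚ) + 1)) ≤ 1 := by push_cast at h1; simpa using h1
  have e : (-1 : ℚ) ^ l / ((l : ℚ) + 1) ^ 2 = (-1) ^ l * (1 / ((l : ℚ) + 1)) * (1 / ((l : ℚ) + 1)) := by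
    field_simp
  rw [e, padicNorm.mul, padicNorm.mul]
  calc padicNorm p ((-1 : ℚ) ^ l) * padicNorm p (1 / ((l : ℚ) + 1)) * padicNorm p (1 / ((l : ℚ) + 1))
      ≤ 1 * 1 * 1 := mul_le_mul (mul_le_mul hs h1' (padicNorm.nonneg _) zero_le_one) h1' (padicNorm.nonneg _)
          (by positivity)
    _ = 1 := by ring

/-- `‖(−1)^ℓ/(ℓ+1)‖_p ≤ 1` when `p ∤ ℓ+1`. -/
theorem padicNorm_altTerm1_le_one {l : ℕ} (h : ¬ (p : ℤ) ^ (0 + 1) ∣ ((l : ℤ) + 1)) :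
    padicNorm p ((-1 : ℚ) ^ l / ((l : ℚ) + 1)) ≤ 1 := by
  have hs : padicNorm p ((-1 : ℚ) ^ l) ≤ 1 := by
    have := padicNorm.of_int (p := p) ((-1) ^ l); push_cast at this; exact this
  have hne : ((l : ℤ) + 1) ≠ 0 := by omega
  have h1 : padicNorm p (1 / (((l + 1 : ℤ) : ℤ) : ℚ)) ≤ (p : ℚ) ^ ((0 : ℕ) : ℤ) :=
    padicNorm_inv_int_le_pow (p := p) hne (j := 0) h
  have h1' : padicNorm p (1 / ((l : ℚ) + 1)) ≤ 1 := by push_cast at h1; simpa using h1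
  have e : (-1 : ℚ) ^ l / ((l : ℚ) + 1) = (-1) ^ l * (1 / ((l : ℚ) + 1)) := by ring
  rw [e, padicNorm.mul]
  calc padicNorm p ((-1 : ℚ) ^ l) * padicNorm p (1 / ((l : ℚ) + 1)) ≤ 1 * 1 :=
        mul_le_mul hs h1' (padicNorm.nonneg _) zero_le_one
    _ = 1 := one_mul _

/-- The `ℓ = p` term of `harmAlt2`: `(−1)^{p−1}/p² = 1/p²` (`p` odd). -/
theorem altTerm2_at (h2 : p ≠ 2) : (-1 : ℚ) ^ (p - 1) / (((p - 1 : ℕ) : ℚ) + 1) ^ 2 = 1 / (p : ℚ) ^ 2 := by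
  rw [(hp.out.even_sub_one h2).neg_one_pow, Nat.cast_sub hp.out.one_le]; push_cast; ring

/-- The `ℓ = p` term of `harmAlt1`: `(−1)^{p−1}/p = 1/p` (`p` odd). -/
theorem altTerm1_at (h2 : p ≠ 2) : (-1 : ℚ) ^ (p - 1) / (((p - 1 : ℕ) : ℚ) + 1) = 1 / (p : ℚ) := by
  rw [(hp.out.even_sub_one h2).neg_one_pow, Nat.cast_sub hp.out.one_le]; push_cast; ring

/-- **Slice of `harmAlt2`**: for `p ≤ m < 2p` (`p` odd), `‖Σ_{ℓ≤m} (−1)^{ℓ−1}/ℓ² − 1/p²‖_p ≤ 1`. -/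
theorem padicNorm_harmAlt2_sub_le (h2 : p ≠ 2) {m : ℕ} (hpm : p ≤ m) (hm : m < 2 * p) :
    padicNorm p (harmAlt2 m - 1 / (p : ℚ) ^ 2) ≤ 1 := by
  have hmem : p - 1 ∈ range m := mem_range.2 (by have := hp.out.one_le; omega)
  unfold harmAlt2
  rw [← add_sum_erase _ _ hmem, altTerm2_at h2, add_sub_cancel_left]
  refine padicNorm.sum_le' (fun l hl => ?_) zero_le_one
  have hne := ne_of_mem_erase hl
  have hl' := mem_range.1 (mem_of_mem_erase hl)
  exact padicNorm_altTerm2_le_one (not_dvd_succ_of_lt_two_mul hm hl' hne)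

/-- **Slice of `harmAlt1`**: for `p ≤ m < 2p` (`p` odd), `‖Σ_{ℓ≤m} (−1)^{ℓ−1}/ℓ − 1/p‖_p ≤ 1`. -/
theorem padicNorm_harmAlt1_sub_le (h2 : p ≠ 2) {m : ℕ} (hpm : p ≤ m) (hm : m < 2 * p) :
    padicNorm p (harmAlt1 m - 1 / (p : ℚ)) ≤ 1 := by
  have hmem : p - 1 ∈ range m := mem_range.2 (by have := hp.out.one_le; omega)
  unfold harmAlt1
  rw [← add_sum_erase _ _ hmem, altTerm1_at h2, add_sub_cancel_left]
  refine padicNorm.sum_le' (fun l hl => ?_) zero_le_one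
  have hne := ne_of_mem_erase hl
  have hl' := mem_range.1 (mem_of_mem_erase hl)
  exact padicNorm_altTerm1_le_one (not_dvd_succ_of_lt_two_mul hm hl' hne)

end Harmonic

/-! ### `E(k) ≥ 1` facts and `A_k, B_k ∈ ℤ_p` for `p > 17n` -/

section LargePrime

variable {n : ℕ} {p : ℕ} [hp : Fact p.Prime]

/-- `26n < p²` when `17n < p` (`n ≥ 1`). -/
theorem sq_bound_of_gt (hn : 1 ≤ n) (hp17 : 17 * n < p) : 26 * n < p ^ 2 := by
  have := hp.out.two_le; nlinarith

/-- `⌊x/p⌋ = −1` for `−p ≤ x < 0`. -/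
theorem ediv_eq_neg_one {x : ℤ} (h0 : -(p : ℤ) ≤ x) (h1 : x < 0) : x / (p : ℤ) = -1 :=
  ediv_eq_of_bounds (by exact_mod_cast hp.out.pos) ⟨by linarith, by linarith⟩

/-- Zone β₁ (`15n+1 ≤ k ≤ 16n`), `p > 17n`: `E(k) ≥ 1` (the doubled block straddles `0`). -/
theorem one_le_EZ_zoneB1 (hp17 : 17 * n < p) {k : ℤ} (h1 : 15 * (n : ℤ) + 1 ≤ k) (h2 : k ≤ 16 * (n : ℤ)) :
    1 ≤ EZ p n k := by
  have hp' : (0 : ℤ) < p := by exact_mod_cast hp.out.pos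
  have hp17' : 17 * (n : ℤ) < p := by exact_mod_cast hp17
  have f1 : (2 * k - (15 * (n : ℤ) + 2)) / (p : ℤ) = 0 := Int.ediv_eq_zero_of_lt (by omega) (by omega)
  have f2 : (2 * k - (32 * (n : ℤ) + 2)) / (p : ℤ) = -1 := ediv_eq_neg_one (by omega) (by omega)
  have f3 : (17 * (n : ℤ)) / (p : ℤ) = 0 := Int.ediv_eq_zero_of_lt (by omega) (by omega)
  have c2 := WellPoisedFace.ediv_add_carry (k - (11 * (n : ℤ) + 1)) (5 * n) hp'
  have c3 := WellPoisedFace.ediv_add_carry (k - (13 * (n : ℤ) + 1)) (24 * n + 1 - k) hp'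
  have c4 := WellPoisedFace.ediv_add_carry (k - (15 * (n : ℤ) + 1)) (26 * n + 1 - k) hp'
  have e2 : k - (11 * (n : ℤ) + 1) + 5 * n = k - (6 * n + 1) := by ring
  have e3 : k - (13 * (n : ℤ) + 1) + (24 * n + 1 - k) = 11 * n := by ring
  have e4 : k - (15 * (n : ℤ) + 1) + (26 * n + 1 - k) = 11 * n := by ring
  rw [e2] at c2; rw [e3] at c3; rw [e4] at c4
  unfold EZ; omega

/-- Zone γ (`24n+2 ≤ k ≤ 26n+1`), `p > 17n`: `E(k) ≥ 1` (the simple pole: `⌊(24n+1−k)/p⌋ = −1`). -/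
theorem one_le_EZ_zoneG (hp17 : 17 * n < p) {k : ℤ} (h1 : 24 * (n : ℤ) + 2 ≤ k) (h2 : k ≤ 26 * (n : ℤ) + 1) :
    1 ≤ EZ p n k := by
  have hp' : (0 : ℤ) < p := by exact_mod_cast hp.out.pos
  have hp17' : 17 * (n : ℤ) < p := by exact_mod_cast hp17
  have f1 : (11 * (n : ℤ)) / (p : ℤ) = 0 := Int.ediv_eq_zero_of_lt (by omega) (by omega)
  have f2 : (k - (13 * (n : ℤ) + 1)) / (p : ℤ) = 0 := Int.ediv_eq_zero_of_lt (by omega) (by omega)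
  have f3 : (24 * (n : ℤ) + 1 - k) / (p : ℤ) = -1 := ediv_eq_neg_one (by omega) (by omega)
  have c1 := WellPoisedFace.ediv_add_carry (2 * k - (32 * (n : ℤ) + 2)) (17 * n) hp'
  have c2 := WellPoisedFace.ediv_add_carry (k - (11 * (n : ℤ) + 1)) (5 * n) hp'
  have c4 := WellPoisedFace.ediv_add_carry (k - (15 * (n : ℤ) + 1)) (26 * n + 1 - k) hp'
  have e1 : 2 * k - (32 * (n : ℤ) + 2) + 17 * n = 2 * k - (15 * n + 2) := by ring
  have e2 : k - (11 * (n : ℤ) + 1) + 5 * n = k - (6 * n + 1) := by ring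
  have e4 : k - (15 * (n : ℤ) + 1) + (26 * n + 1 - k) = 11 * n := by ring
  rw [e1] at c1; rw [e2] at c2; rw [e4] at c4
  unfold EZ; omega

omit hp in
/-- Zone β₂ (`16n+1 ≤ k ≤ 24n+1`), `p > 17n`: the four digits `⌊(k−13n−1)/p⌋, ⌊(24n+1−k)/p⌋, ⌊(k−15n−1)/p⌋,
⌊(26n+1−k)/p⌋` vanish. -/
theorem digits_zoneB2 (hp17 : 17 * n < p) {k : ℤ} (h1 : 16 * (n : ℤ) + 1 ≤ k) (h2 : k ≤ 24 * (n : ℤ) + 1) :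
    ((k - (13 * (n : ℤ) + 1)) / (p : ℤ) = 0 ∧ (24 * (n : ℤ) + 1 - k) / (p : ℤ) = 0) ∧
    ((k - (15 * (n : ℤ) + 1)) / (p : ℤ) = 0 ∧ (26 * (n : ℤ) + 1 - k) / (p : ℤ) = 0) := by
  have hp17' : 17 * (n : ℤ) < p := by exact_mod_cast hp17
  exact ⟨⟨Int.ediv_eq_zero_of_lt (by omega) (by omega), Int.ediv_eq_zero_of_lt (by omega) (by omega)⟩,
    ⟨Int.ediv_eq_zero_of_lt (by omega) (by omega), Int.ediv_eq_zero_of_lt (by omega) (by omega)⟩⟩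

/-- Zone β₂, `p > 17n`: if the doubled block `[2k−32n−1, 2k−15n−2]` or the block `[k−11n, k−6n−1]` contains a
multiple of `p`, then `E(k) ≥ 1`. -/
theorem one_le_EZ_zoneB2 (hp17 : 17 * n < p) {k : ℤ} (h1 : 16 * (n : ℤ) + 1 ≤ k) (h2 : k ≤ 24 * (n : ℤ) + 1)
    (h : (2 * k - (15 * (n : ℤ) + 2)) / (p : ℤ) ≠ (2 * k - (32 * (n : ℤ) + 2)) / (p : ℤ) ∨
      (k - (6 * (n : ℤ) + 1)) / (p : ℤ) ≠ (k - (11 * (n : ℤ) + 1)) / (p : ℤ)) :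
    1 ≤ EZ p n k := by
  have hp' : (0 : ℤ) < p := by exact_mod_cast hp.out.pos
  have hp17' : 17 * (n : ℤ) < p := by exact_mod_cast hp17
  obtain ⟨⟨d1, d2⟩, d3, d4⟩ := digits_zoneB2 hp17 h1 h2
  have f1 : (11 * (n : ℤ)) / (p : ℤ) = 0 := Int.ediv_eq_zero_of_lt (by omega) (by omega)
  have f2 : (17 * (n : ℤ)) / (p : ℤ) = 0 := Int.ediv_eq_zero_of_lt (by omega) (by omega)
  have f3 : (5 * (n : ℤ)) / (p : ℤ) = 0 := Int.ediv_eq_zero_of_lt (by omega) (by omega)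
  have m0 : (2 * k - (32 * (n : ℤ) + 2)) / (p : ℤ) ≤ (2 * k - (15 * (n : ℤ) + 2)) / (p : ℤ) :=
    Int.ediv_le_ediv hp' (by omega)
  have m1 : (k - (11 * (n : ℤ) + 1)) / (p : ℤ) ≤ (k - (6 * (n : ℤ) + 1)) / (p : ℤ) :=
    Int.ediv_le_ediv hp' (by omega)
  unfold EZ
  rcases h with h | h <;> omega

/-- **`‖A_k‖_p ≤ 1` for `p > 17n`** on `15n+1 ≤ k ≤ 24n+1`. -/
theorem padicNorm_coefAT_le_one (hn : 1 ≤ n) (hp17 : 17 * n < p) {k : ℤ} (h1 : 15 * (n : ℤ) + 1 ≤ k)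
    (h2 : k ≤ 24 * (n : ℤ) + 1) : padicNorm p (coefAT (aT n) (bT n) k) ≤ 1 := by
  have _ := hp17
  rcases le_or_gt k (16 * (n : ℤ)) with hk | hk
  · rw [coefAT_zoneB1 h1 hk, padicNorm.zero]; exact zero_le_one
  refine (padicNorm_coefAT_le hn (by omega) h2).trans ?_
  exact zpow_le_one_of_nonpos₀ (by exact_mod_cast hp.out.one_lt.le) (by linarith [EZ_nonneg hp.out.pos n k])

/-- **`‖B_k‖_p ≤ 1` for `p > 17n`** on the whole range `13n+1 ≤ k ≤ 26n+1` — eq. (T3) at the primes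
`p ∤ D_{17n}`. -/
theorem padicNorm_coefBT_le_one (hn : 1 ≤ n) (hp17 : 17 * n < p) {k : ℤ} (h1 : 13 * (n : ℤ) + 1 ≤ k)
    (h2 : k ≤ 26 * (n : ℤ) + 1) : padicNorm p (coefBT (aT n) (bT n) k) ≤ 1 := by
  have hp1 : (1 : ℚ) ≤ p := by exact_mod_cast hp.out.one_lt.le
  have hp2 := sq_bound_of_gt hn hp17
  rcases le_or_gt k (15 * (n : ℤ)) with hk | hk
  · rw [coefBT_zoneA h1 hk, padicNorm.zero]; exact zero_le_one
  rcases le_or_gt k (16 * (n : ℤ)) with hk' | hk'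
  · refine (padicNorm_coefBT_zoneB1 hp2 (by omega) hk').trans ?_
    exact zpow_le_one_of_nonpos₀ hp1 (by linarith [one_le_EZ_zoneB1 hp17 (by omega : 15 * (n : ℤ) + 1 ≤ k) hk'])
  rcases le_or_gt k (24 * (n : ℤ) + 1) with hk'' | hk''
  · by_cases d0 : (2 * k - (15 * (n : ℤ) + 2)) / (p : ℤ) = (2 * k - (32 * (n : ℤ) + 2)) / (p : ℤ)
    · by_cases d1 : (k - (6 * (n : ℤ) + 1)) / (p : ℤ) = (k - (11 * (n : ℤ) + 1)) / (p : ℤ)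
      · obtain ⟨d2, d3⟩ := digits_zoneB2 hp17 (by omega) hk''
        refine (padicNorm_coefBT_zoneB2_sharp hn (by omega) hk'' d0 d1 d2 d3).trans ?_
        exact zpow_le_one_of_nonpos₀ hp1 (by linarith [EZ_nonneg hp.out.pos n k])
      · refine (padicNorm_coefBT_zoneB2 hn hp2 (by omega) hk'').trans ?_
        exact zpow_le_one_of_nonpos₀ hp1 (by linarith [one_le_EZ_zoneB2 hp17 (by omega) hk'' (Or.inr d1)])
    · refine (padicNorm_coefBT_zoneB2 hn hp2 (by omega) hk'').trans ?_
      exact zpow_le_one_of_nonpos₀ hp1 (by linarith [one_le_EZ_zoneB2 hp17 (by omega) hk'' (Or.inl d0)])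
  · refine (padicNorm_coefBT_zoneG hp2 (by omega) h2).trans ?_
    exact zpow_le_one_of_nonpos₀ hp1 (by linarith [one_le_EZ_zoneG hp17 (by omega : 24 * (n : ℤ) + 2 ≤ k) h2])

end LargePrime

end Summit.KontsevichZagierPeriods.Zeta5Search.TwoTaleP15

end
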